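import Mathlib
import Literature.AlgebraicGeometry.Resolution.WeightedInitialTerms
import HarnessLib

/-!
# [OURS · L1 W4.5(b) · EL♮(3)] HSUB(ReachTC⁺) — THE ADAPTED FRAME at a regular point of the in-carrier surface: `c = (h, c₁, c₂)`
# with `(c) = (ker s)_p`, the carrier `h = c₀` and the cone `f = Φ(c₁, c₂)` a LINEAR form with a unit coefficient (registered stub
# `stub_elnat_tcPlusPointResolution`; brick K7c — the input shape of p522194 / K7b p530905 / (n1))

Crux `EquisingularLiftNat` = stmt-ResolutionOfSingularities-20038 (child EL♮(3) = stmt-ResolutionOfSingularities-20148), route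
EquisingularLift, line `sections`. Helper file `--supports stmt-ResolutionOfSingularities-20148 --as helper` by res-L1-w45b-stub-1
(HSUB(ReachTC⁺) assembly). HONEST FRAMING: OURS (cell res-hironaka, slot W4.5(b)); elementary linear algebra over a local ring; NOT a
statement of any manuscript; AI-written, weaker than expert review. No `sorry`; standard axioms.

WHY. The stalk lemmas of the carrier pair (res-L1-w45b-stub-1 …NatCarrierStrictTransformStalks p522194, res-L1-w45b-stub-2 K7b
…NatInCarrierStepFlat p530905, res-D-pv-029 (n1)) want the section frame `c` ADAPTED to the pair: the carrier's local equation IS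
`c₀` and the cone's local equation is a form `Φ` in the TAIL `(c₁, c₂)`. At a regular point of `D = V(h) ∩ V(f)` the order-one
information `h ∉ 𝔪²`, `f ∉ (h) + 𝔪²` (…NatCodimTwoOrderOne p531429) lets one re-adapt ANY 3-frame `c⁰` of `(ker s)_p`:

* (`range_fin_three` from Literature WeightedInitialTerms;) `span_triple_eq_of_isUnit` — exchange lemma: `a x + b y + d z = w` with `a` a unit ⇒ `(w, y, z) = (x, y, z)`;
* **`exists_adaptedFrame`** — `∃ c Φ, (c) = (c⁰) ∧ c₀ = h ∧ Φ ∈ A[T₁,T₂]₁ ∧ Φ(c₁, c₂) = f ∧ some coefficient of Φ is a unit`.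

References: folklore (Nakayama-free exchange in a local ring).
-/

set_option linter.dupNamespace false -- mandated namespace `Summit.<Summit>.<Problem>` of this single-conjunct summit

noncomputable section

open MvPolynomial IsLocalRing Literature.AlgebraicGeometry.Resolution

namespace Summit.ResolutionOfSingularities.ResolutionOfSingularities.Cruxes.EquisingularLiftNat.Sections

universe u

variable {A : Type u} [CommRing A]

/-- **Exchange lemma.** `a·x + b·y + d·z = w` with `a` a unit ⇒ `(w, y, z) = (x, y, z)` as ideals. [folklore] -/
theorem span_triple_eq_of_isUnit {x y z w a b d : A} (ha : IsUnit a) (e : a * x + b * y + d * z = w) :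
    Ideal.span ({w, y, z} : Set A) = Ideal.span {x, y, z} := by
  have hy : ∀ s : Set A, y ∈ s → y ∈ Ideal.span s := fun s hs => Ideal.subset_span hs
  apply le_antisymm
  · refine Ideal.span_le.mpr ?_
    rintro v (rfl | rfl | rfl)
    · rw [← e]
      refine Ideal.add_mem _ (Ideal.add_mem _ (Ideal.mul_mem_left _ _ (Ideal.subset_span (by simp)))
        (Ideal.mul_mem_left _ _ (Ideal.subset_span (by simp)))) (Ideal.mul_mem_left _ _ (Ideal.subset_span (by simp)))
    · exact Ideal.subset_span (by simp)
    · exact Ideal.subset_span (by simp)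
  · refine Ideal.span_le.mpr ?_
    rintro v (rfl | rfl | rfl)
    · obtain ⟨u, hu⟩ := ha
      have hx : v = ↑u⁻¹ * (w - b * y - d * z) := by
        rw [← e, ← hu]
        have : (↑u⁻¹ : A) * (↑u * v + b * y + d * z - b * y - d * z) = (↑u⁻¹ * ↑u) * v := by ring
        rw [this, Units.inv_mul, one_mul]
      rw [hx]
      refine Ideal.mul_mem_left _ _ (Ideal.sub_mem _ (Ideal.sub_mem _ (Ideal.subset_span (by simp))
        (Ideal.mul_mem_left _ _ (Ideal.subset_span (by simp)))) (Ideal.mul_mem_left _ _ (Ideal.subset_span (by simp))))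
    · exact Ideal.subset_span (by simp)
    · exact Ideal.subset_span (by simp)

/-- In a local ring, a combination `Σ aᵢ cᵢ` of elements of `𝔪` with NO unit coefficient lies in `𝔪²`. [folklore] -/
theorem sum_three_mem_sq_of_forall_not_isUnit [IsLocalRing A] {c : Fin 3 → A} (hc : ∀ i, c i ∈ maximalIdeal A) {a : Fin 3 → A}
    (ha : ∀ i, ¬ IsUnit (a i)) : a 0 * c 0 + a 1 * c 1 + a 2 * c 2 ∈ maximalIdeal A ^ 2 := by
  have hm : ∀ i, a i * c i ∈ maximalIdeal A ^ 2 := fun i => by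
    rw [pow_two]; exact Ideal.mul_mem_mul ((mem_maximalIdeal _).mpr (mem_nonunits_iff.mpr (ha i))) (hc i)
  exact Ideal.add_mem _ (Ideal.add_mem _ (hm 0) (hm 1)) (hm 2)

/-- **The adapted frame.** `A` local, `c⁰` a `3`-frame in `𝔪`, `h, f ∈ (c⁰)` with `h ∉ 𝔪²` and `f ∉ (h) + 𝔪²`. Then there are a
`3`-frame `c` with `(c) = (c⁰)`, `c₀ = h`, and a linear form `Φ ∈ A[T₁, T₂]` with a UNIT coefficient and `Φ(c₁, c₂) = f`.
[folklore] [OURS · L1 W4.5b] brick K7c toward `stub_elnat_tcPlusPointResolution`; NOT a statement of the manuscript. -/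
theorem exists_adaptedFrame [IsLocalRing A] (c₀ : Fin 3 → A) (hc₀ : ∀ i, c₀ i ∈ maximalIdeal A) {h f : A}
    (hh : h ∈ Ideal.span (Set.range c₀)) (hf : f ∈ Ideal.span (Set.range c₀)) (hh2 : h ∉ maximalIdeal A ^ 2)
    (hf2 : f ∉ Ideal.span {h} ⊔ maximalIdeal A ^ 2) :
    ∃ (c : Fin 3 → A) (Φ : MvPolynomial (Fin 2) A), Ideal.span (Set.range c) = Ideal.span (Set.range c₀) ∧ c 0 = h ∧
      Φ.IsHomogeneous 1 ∧ MvPolynomial.eval (fun l : Fin 2 => c l.succ) Φ = f ∧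
      ∃ l : Fin 2, IsUnit (Φ.coeff (Finsupp.single l 1)) := by
  classical
  have hI𝔪 : Ideal.span (Set.range c₀) ≤ maximalIdeal A := Ideal.span_le.mpr (by rintro _ ⟨i, rfl⟩; exact hc₀ i)
  have hhm : h ∈ maximalIdeal A := hI𝔪 hh
  -- (1) put `h` in the frame
  obtain ⟨a, ha⟩ := Ideal.mem_span_range_iff_exists_fun.mp hh
  rw [Fin.sum_univ_three] at ha
  have hunit : ∃ i, IsUnit (a i) := by
    by_contra hne
    push Not at hne
    exact hh2 (ha ▸ sum_three_mem_sq_of_forall_not_isUnit hc₀ hne)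
  -- a frame `(h, u, v)` with the same span, `u, v ∈ 𝔪`
  obtain ⟨u, v, hu, hv, hspan₁⟩ : ∃ u v : A, u ∈ maximalIdeal A ∧ v ∈ maximalIdeal A ∧
      Ideal.span ({h, u, v} : Set A) = Ideal.span (Set.range c₀) := by
    obtain ⟨i, hi⟩ := hunit
    rw [range_fin_three]
    fin_cases i
    · exact ⟨c₀ 1, c₀ 2, hc₀ 1, hc₀ 2, span_triple_eq_of_isUnit hi ha⟩
    · refine ⟨c₀ 0, c₀ 2, hc₀ 0, hc₀ 2, ?_⟩
      have e : a 1 * c₀ 1 + a 0 * c₀ 0 + a 2 * c₀ 2 = h := by rw [← ha]; ring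
      have hs : ({c₀ 1, c₀ 0, c₀ 2} : Set A) = {c₀ 0, c₀ 1, c₀ 2} := by
        ext; simp only [Set.mem_insert_iff, Set.mem_singleton_iff]; tauto
      rw [span_triple_eq_of_isUnit hi e, hs]
    · refine ⟨c₀ 0, c₀ 1, hc₀ 0, hc₀ 1, ?_⟩
      have e : a 2 * c₀ 2 + a 0 * c₀ 0 + a 1 * c₀ 1 = h := by rw [← ha]; ring
      have hs : ({c₀ 2, c₀ 0, c₀ 1} : Set A) = {c₀ 0, c₀ 1, c₀ 2} := by
        ext; simp only [Set.mem_insert_iff, Set.mem_singleton_iff]; tauto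
      rw [span_triple_eq_of_isUnit hi e, hs]
  -- (2) write `f` in the frame `(h, u, v)`
  have hf' : f ∈ Ideal.span (Set.range ![h, u, v]) := by rw [range_fin_three]; simpa [hspan₁] using hf
  obtain ⟨b, hb⟩ := Ideal.mem_span_range_iff_exists_fun.mp hf'
  rw [Fin.sum_univ_three] at hb
  simp only [Matrix.cons_val_zero, Matrix.cons_val_one, Matrix.cons_val] at hb
  have hunit₂ : IsUnit (b 1) ∨ IsUnit (b 2) := by
    by_contra hne
    push Not at hne
    apply hf2
    rw [Ideal.mem_span_singleton_sup]
    refine ⟨b 0, b 1 * u + b 2 * v, ?_, by rw [← hb]; ring⟩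
    rw [pow_two]
    exact Ideal.add_mem _ (Ideal.mul_mem_mul ((mem_maximalIdeal _).mpr (mem_nonunits_iff.mpr hne.1)) hu)
      (Ideal.mul_mem_mul ((mem_maximalIdeal _).mpr (mem_nonunits_iff.mpr hne.2)) hv)
  rcases hunit₂ with h1 | h2
  · -- `c = (h, b₀h + b₁u, v)`, `Φ = T₁ + b₂ T₂`
    refine ⟨![h, b 0 * h + b 1 * u, v], X 0 + C (b 2) * X 1, ?_, rfl, ?_, ?_, 0, ?_⟩
    · rw [range_fin_three, ← hspan₁]
      simp only [Matrix.cons_val_zero, Matrix.cons_val_one, Matrix.cons_val]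
      have e : b 1 * u + b 0 * h + 0 * v = b 0 * h + b 1 * u := by ring
      have hs₁ : ({h, b 0 * h + b 1 * u, v} : Set A) = {b 0 * h + b 1 * u, h, v} := by
        ext; simp only [Set.mem_insert_iff, Set.mem_singleton_iff]; tauto
      have hs₂ : ({u, h, v} : Set A) = {h, u, v} := by
        ext; simp only [Set.mem_insert_iff, Set.mem_singleton_iff]; tauto
      rw [hs₁, span_triple_eq_of_isUnit h1 e, hs₂]
    · exact (isHomogeneous_X A 0).add ((isHomogeneous_X A 1).C_mul (b 2))
    · simp only [map_add, map_mul, eval_X, eval_C, Fin.succ_zero_eq_one, Fin.succ_one_eq_two, Matrix.cons_val_one,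
        Matrix.cons_val]
      linear_combination hb
    · simp [coeff_add, coeff_C_mul, coeff_X, Finsupp.single_eq_single_iff]
  · -- `c = (h, u, b₀h + b₂v)`, `Φ = b₁ T₁ + T₂`
    refine ⟨![h, u, b 0 * h + b 2 * v], C (b 1) * X 0 + X 1, ?_, rfl, ?_, ?_, 1, ?_⟩
    · rw [range_fin_three, ← hspan₁]
      simp only [Matrix.cons_val_zero, Matrix.cons_val_one, Matrix.cons_val]
      have e : b 2 * v + b 0 * h + 0 * u = b 0 * h + b 2 * v := by ring
      have hs₁ : ({h, u, b 0 * h + b 2 * v} : Set A) = {b 0 * h + b 2 * v, h, u} := by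
        ext; simp only [Set.mem_insert_iff, Set.mem_singleton_iff]; tauto
      have hs₂ : ({v, h, u} : Set A) = {h, u, v} := by
        ext; simp only [Set.mem_insert_iff, Set.mem_singleton_iff]; tauto
      rw [hs₁, span_triple_eq_of_isUnit h2 e, hs₂]
    · exact ((isHomogeneous_X A 0).C_mul (b 1)).add (isHomogeneous_X A 1)
    · simp only [map_add, map_mul, eval_X, eval_C, Fin.succ_zero_eq_one, Fin.succ_one_eq_two, Matrix.cons_val_one,
        Matrix.cons_val]
      linear_combination hb
    · simp [coeff_add, coeff_C_mul, coeff_X, Finsupp.single_eq_single_iff]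

end Summit.ResolutionOfSingularities.ResolutionOfSingularities.Cruxes.EquisingularLiftNat.Sections

end
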